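import Literature.MathematicalPhysics.QuantumFieldTheory.ConformalBootstrap3D.PointKernelMoments
import Literature.Analysis.ValidatedNumerics.TaylorModelRate
import Literature.Analysis.ValidatedNumerics.TaylorModelEdgePanel
import Literature.Analysis.ValidatedNumerics.IntervalLogArctan
import HarnessLib

/-!
# Kernel v3: the Taylor-model cell kernel (node sides, node groups, the cell number)

[folklore] validated numerics on top of [cite: HogervorstRychkov2013, §3 eq. (3.6)].

A cell is `Δ ∈ [A - h, A + h]`, `h = 2^{-e}`, an `s`-piece is `s = σ + θ δ`, `θ ∈ [0, 1]`.  For every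
node side the kernel builds Taylor models in `ρ = Δ - A` of the three `θ`-coefficients of the
minorant of `PointFunctionalNodeCell` (`nodeG`): amplitude `w v^σ` (resp. `-w u^σ`) and
`u^{A/2}` from the certified powers of the certificate (`PCert.powU/powV`), the power-sandwich
coefficients `qCoeffs` of `r = v^δ` (resp. `u^δ`), `u^{ρ/2} = e^{ρ (log u)/2}` by `texpMI` with the
interval rate `logPos(u)/2`, and the node head sum by `nodeMomTM` (file `PointKernelMoments`).
Node sides are accumulated over node groups (`gPart`), groups over the cell (`sumG`, `PartsOK`),
and the cell passes iff `0 ≤ lower3` (`cellNumber`).  Main theorem: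
`headG_nonneg_of_cellNumber` = the `hpos` hypothesis of
`blockPositive_pointFunctional_of_headG_Ico` on `[A - h, A + h]`.
-/

namespace Literature.MathematicalPhysics.QuantumFieldTheory.ConformalBootstrap3D

namespace PKTM

open Literature.Analysis.ValidatedNumerics (rall vget vtab)
open Literature.Analysis.ValidatedNumerics.PolyMP
open Literature.Analysis.ValidatedNumerics.NumericsMP
open PointKernel (mulQ mem_mulQ PowReq PCert legTab)
open Finset Real Set

/-! ### Requests -/

/-- A cell request: spin, centre, half-width `2^{-e}`, degree, head depth, exp order, log fuel,
and the power request of the exponent `A/2`. [folklore] -/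
structure TMCell where
  /-- spin -/
  ℓ : ℕ
  /-- centre -/
  A : ℚ
  /-- `h = 2^{-e}` -/
  e : ℕ
  /-- Taylor degree -/
  D : ℕ
  /-- head depth `n_F` -/
  nF : ℕ
  /-- order of the exponential model -/
  K : ℕ
  /-- fuel of `logPos` -/
  Klog : ℕ
  /-- request of the exponent `A/2` -/
  rA : PowReq

/-- An `s`-piece request: the exponents `σ` and `δ` (`s = σ + θδ`). [folklore] -/
structure TMPiece where
  /-- request of `σ` -/
  rSig : PowReq
  /-- request of `δ` -/
  rDel : PowReq

/-- the half-width. [folklore] -/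
def TMCell.h (t : TMCell) : ℚ := 1 / 2 ^ t.e

/-! ### The power-sandwich coefficients -/

/-- `(c₁, c₂)` of `qlo r` (if `lo`) or `qhi r` (else); `c₀ = 1`. [folklore] -/
def qCoeffs (S : ℕ) (lo : Bool) (R : MI) : Option (MI × MI) :=
  if lo then
    match MI.divPos S (MI.sub (MI.ofInt S 1) R) R with
    | some t => some (MI.sub (MI.neg (MI.sub (MI.ofInt S 1) R)) ((MI.sqr S t).divNat 2), (MI.sqr S t).divNat 2)
    | none => none
  else
    some (MI.sub (MI.neg (MI.sub (MI.ofInt S 1) R))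
        ((MI.mul S R (MI.sqr S (MI.sub (MI.ofInt S 1) R))).divNat 2),
      (MI.mul S R (MI.sqr S (MI.sub (MI.ofInt S 1) R))).divNat 2)

/-- **Soundness of `qCoeffs`** against `qselCoeff`. [folklore] -/
theorem mem_qCoeffs {S : ℕ} (hS : 0 < S) {lo : Bool} {R c1 c2 : MI} {r a : ℝ} (hR : MI.mem S r R)
    (hlo : lo = true ↔ 0 ≤ a) (h : qCoeffs S lo R = some (c1, c2)) :
    MI.mem S (qselCoeff a r 1) c1 ∧ MI.mem S (qselCoeff a r 2) c2 := by
  have h1 : MI.mem S (1 - r) (MI.sub (MI.ofInt S 1) R) := by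
    simpa using MI.mem_sub (MI.mem_ofInt S 1) hR
  unfold qCoeffs at h
  cases lo with
  | true =>
    have ha : 0 ≤ a := hlo.mp rfl
    simp only [if_true] at h
    cases ht : MI.divPos S (MI.sub (MI.ofInt S 1) R) R with
    | none => simp [ht] at h
    | some t =>
      simp only [ht, Option.some.injEq, Prod.mk.injEq] at h
      obtain ⟨rfl, rfl⟩ := h
      have hpos : 0 < R.lo := by
        by_contra hneg
        simp [MI.divPos, hneg] at ht
      have hr0 : 0 < r := by
        have hSr : (0 : ℝ) < S := by exact_mod_cast hS
        have : (0 : ℝ) < R.lo := by exact_mod_cast hpos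
        nlinarith [hR.1]
      have hmt : MI.mem S (1 / r - 1) t := by
        have := MI.mem_divPos hS ht h1 hR
        rwa [show (1 - r) / r = 1 / r - 1 by field_simp] at this
      have hc2 : MI.mem S ((1 / r - 1) ^ 2 / 2) ((MI.sqr S t).divNat 2) := by
        simpa using MI.mem_divNat (MI.mem_sqr hS hmt) (by norm_num : 0 < 2)
      refine ⟨?_, ?_⟩
      · simp only [qselCoeff, if_pos ha, qloCoeff]
        exact MI.mem_sub (MI.mem_neg h1) hc2
      · simp only [qselCoeff, if_pos ha, qloCoeff]
        exact hc2
  | false =>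
    have ha : ¬ 0 ≤ a := fun h' => by simpa using hlo.mpr h'
    simp only [Bool.false_eq_true, if_false, Option.some.injEq, Prod.mk.injEq] at h
    obtain ⟨rfl, rfl⟩ := h
    have hc2 : MI.mem S (r * (1 - r) ^ 2 / 2)
        ((MI.mul S R (MI.sqr S (MI.sub (MI.ofInt S 1) R))).divNat 2) := by
      simpa using MI.mem_divNat (MI.mem_mul hS hR (MI.mem_sqr hS h1)) (by norm_num : 0 < 2)
    refine ⟨?_, ?_⟩
    · simp only [qselCoeff, if_neg ha, qhiCoeff]
      exact MI.mem_sub (MI.mem_neg h1) hc2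
    · simp only [qselCoeff, if_neg ha, qhiCoeff]
      exact hc2

/-! ### Triples of models -/

/-- the three `θ`-coefficient models `(G₀, G₁, G₂)`. [folklore] -/
abbrev G3 := IPoly × IPoly × IPoly

/-- component `m` (`m ≥ 2` ↦ the last). [folklore] -/
def gsel (g : G3) : ℕ → IPoly
  | 0 => g.1
  | 1 => g.2.1
  | _ => g.2.2

/-- componentwise sum. [folklore] -/
def addG (a b : G3) : G3 := (taddI a.1 b.1, taddI a.2.1 b.2.1, taddI a.2.2 b.2.2)

/-- [folklore] -/
theorem gsel_addG (a b : G3) : ∀ m, gsel (addG a b) m = taddI (gsel a m) (gsel b m)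
  | 0 => rfl
  | 1 => rfl
  | _ + 2 => rfl

/-- [folklore] -/
theorem tmem_addG {S : ℕ} {h : ℚ} {f g : ℕ → ℝ → ℝ} {a b : G3} (ha : ∀ m, TMem S h (f m) (gsel a m))
    (hb : ∀ m, TMem S h (g m) (gsel b m)) (m : ℕ) :
    TMem S h (fun ρ => f m ρ + g m ρ) (gsel (addG a b) m) := by
  rw [gsel_addG]; exact tmem_add (ha m) (hb m)

/-- sum of a list of triples. [folklore] -/
def sumG (gs : List G3) : G3 := gs.foldr addG ([], [], [])

/-! ### One node side -/

/-- The three models of one node side with data `(x, y)`, amplitude `amp ∋ a`, ratio `R ∋ r`,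
`Ef ∋ (xy)^{A/2}` and branch `lo`: `a · c_m(r) · (xy)^{(A+ρ)/2} H(x, y, A+ρ)`, `m = 0, 1, 2`.
[folklore] -/
def sideCore (S : ℕ) (t : TMCell) (rs : List (List IPoly)) (x y : ℚ) (amp R Ef : MI) (lo : Bool) :
    Option G3 :=
  match MI.logPos S t.Klog (MI.ofFrac S (x * y).num (x * y).den), qCoeffs S lo R with
  | some L, some cc =>
    if ((L.divNat 2).absHi : ℚ) / S * t.h ≤ 1 then
      some (tsmulI S (MI.mul S amp Ef)
          (tmulI S t.h t.D (momPoly S t.D (moments rs (uTabR S (x * y) t.nF)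
            (vTab S (x * y) (legTab (t.ℓ + t.nF) x y) (t.ℓ + t.nF)) t.D)) (texpMI S t.h t.K (L.divNat 2))),
        tsmulI S (MI.mul S (MI.mul S amp Ef) cc.1)
          (tmulI S t.h t.D (momPoly S t.D (moments rs (uTabR S (x * y) t.nF)
            (vTab S (x * y) (legTab (t.ℓ + t.nF) x y) (t.ℓ + t.nF)) t.D)) (texpMI S t.h t.K (L.divNat 2))),
        tsmulI S (MI.mul S (MI.mul S amp Ef) cc.2)
          (tmulI S t.h t.D (momPoly S t.D (moments rs (uTabR S (x * y) t.nF)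
            (vTab S (x * y) (legTab (t.ℓ + t.nF) x y) (t.ℓ + t.nF)) t.D)) (texpMI S t.h t.K (L.divNat 2))))
    else none
  | _, _ => none

/-- **Soundness of one node side.** [cite: HogervorstRychkov2013, §3 eq. (3.6)] -/
theorem tmem_sideCore {S : ℕ} (hS : 0 < S) {t : TMCell} (hD : 1 ≤ t.D) (hK : 0 < t.K) (hℓ : Even t.ℓ)
    (hpiv : HRTM.pivOK t.A t.ℓ t.e t.nF = true) {x y : ℚ} (hx : 0 < x) (hy : 0 < y)
    {a r : ℝ} {amp R Ef : MI} (hamp : MI.mem S a amp) (hR : MI.mem S r R)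
    (hEf : MI.mem S (((x * y : ℚ) : ℝ) ^ ((t.A : ℝ) / 2)) Ef) {lo : Bool} (hlo : lo = true ↔ 0 ≤ a)
    {g : G3} (h : sideCore S t (HRTM.rows S t.A t.ℓ t.e t.D t.nF) x y amp R Ef lo = some g) :
    ∀ m, m ≤ 2 → TMem S t.h (fun ρ => a * qselCoeff a r m *
      (((x * y : ℚ) : ℝ) ^ (((t.A : ℝ) + ρ) / 2) * nodeHead t.ℓ t.nF (x : ℝ) (y : ℝ) ((t.A : ℝ) + ρ)))
      (gsel g m) := by
  have huq : 0 < x * y := mul_pos hx hy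
  have hu : (0 : ℝ) < ((x * y : ℚ) : ℝ) := by exact_mod_cast huq
  have hh0 : 0 ≤ t.h := by unfold TMCell.h; positivity
  unfold sideCore at h
  cases hL : MI.logPos S t.Klog (MI.ofFrac S (x * y).num (x * y).den) with
  | none => simp [hL] at h
  | some L =>
    cases hq : qCoeffs S lo R with
    | none => simp [hL, hq] at h
    | some cc =>
      simp only [hL, hq] at h
      split_ifs at h with hB
      obtain rfl := Option.some.inj h
      -- the factors
      have hX : MI.mem S (((x * y : ℚ) : ℝ)) (MI.ofFrac S (x * y).num (x * y).den) := by
        have := MI.mem_ofFrac S (x * y).num (x * y).den_pos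
        rwa [show (((x * y).num : ℝ)) / ((x * y).den) = ((x * y : ℚ) : ℝ) by
          rw [Rat.cast_def]] at this
      obtain ⟨-, hlog⟩ := MI.mem_logPos hS hL hX
      have hΛ : MI.mem S (Real.log ((x * y : ℚ) : ℝ) / 2) (L.divNat 2) := by
        simpa using MI.mem_divNat hlog (by norm_num : 0 < 2)
      have hT := tmem_expMI hS hK hΛ hB
      have hM : TMem S t.h (fun ρ => nodeHead t.ℓ t.nF (x : ℝ) (y : ℝ) ((t.A : ℝ) + ρ))
          (momPoly S t.D (moments (HRTM.rows S t.A t.ℓ t.e t.D t.nF) (uTabR S (x * y) t.nF)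
            (vTab S (x * y) (legTab (t.ℓ + t.nF) x y) (t.ℓ + t.nF)) t.D)) :=
        tmem_moments hS hℓ hD hpiv hx hy
      have hF := tmem_mul hS hh0 t.D hM hT
      have hκ := MI.mem_mul hS hamp hEf
      obtain ⟨hc1, hc2⟩ := mem_qCoeffs hS hR hlo hq
      -- the pointwise identity `(xy)^{(A+ρ)/2} = (xy)^{A/2} e^{ρ log(xy)/2}`
      have hsplit : ∀ ρ : ℝ, ((x * y : ℚ) : ℝ) ^ (((t.A : ℝ) + ρ) / 2) =
          ((x * y : ℚ) : ℝ) ^ ((t.A : ℝ) / 2) * Real.exp (Real.log ((x * y : ℚ) : ℝ) / 2 * ρ) := by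
        intro ρ
        rw [show ((t.A : ℝ) + ρ) / 2 = (t.A : ℝ) / 2 + ρ / 2 by ring, Real.rpow_add hu,
          Real.rpow_def_of_pos hu (ρ / 2)]
        ring_nf
      intro m hm
      rcases Nat.le_succ_iff.mp hm with hm1 | rfl
      · rcases Nat.le_succ_iff.mp hm1 with hm0 | rfl
        · obtain rfl : m = 0 := Nat.le_zero.mp hm0
          refine tmem_congr_on (tmem_smulI hS hκ hF) fun ρ _ => ?_
          have e0 : qselCoeff a r 0 = 1 := by unfold qselCoeff; split_ifs <;> rfl
          simp only [e0, hsplit ρ]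
          ring
        · refine tmem_congr_on (tmem_smulI hS (MI.mem_mul hS hκ hc1) hF) fun ρ _ => ?_
          simp only [hsplit ρ]
          ring
      · refine tmem_congr_on (tmem_smulI hS (MI.mem_mul hS hκ hc2) hF) fun ρ _ => ?_
        simp only [hsplit ρ]
        ring

/-- The two sides of node `k` of a certificate. [folklore] -/
def sideG (c : PCert) (t : TMCell) (p : TMPiece) (rs : List (List IPoly)) (k : ℕ) (plus : Bool) :
    Option G3 :=
  if plus then
    sideCore c.S t rs (c.z k) (c.zb k) (mulQ (c.powV k p.rSig) (c.w k)) (c.powV k p.rDel) (c.powU k t.rA)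
      (decide (0 ≤ c.w k))
  else
    sideCore c.S t rs (1 - c.z k) (1 - c.zb k) (mulQ (c.powU k p.rSig) (-(c.w k))) (c.powU k p.rDel)
      (c.powV k t.rA) (decide (c.w k ≤ 0))

/-- The real node term of node `k` as a `ℕ`-indexed function (`= nodeG` on `Fin N`). [folklore] -/
noncomputable def nodeGN (c : PCert) (ℓ nF : ℕ) (σ δ : ℝ) (k m : ℕ) (Δ : ℝ) : ℝ :=
  ((c.w k : ℝ) * ((1 - (c.z k : ℝ)) * (1 - (c.zb k : ℝ))) ^ σ) *
      qselCoeff ((c.w k : ℝ) * ((1 - (c.z k : ℝ)) * (1 - (c.zb k : ℝ))) ^ σ)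
        (((1 - (c.z k : ℝ)) * (1 - (c.zb k : ℝ))) ^ δ) m *
      (((c.z k : ℝ) * (c.zb k : ℝ)) ^ (Δ / 2) * nodeHead ℓ nF (c.z k : ℝ) (c.zb k : ℝ) Δ)
    + (-((c.w k : ℝ) * ((c.z k : ℝ) * (c.zb k : ℝ)) ^ σ)) *
      qselCoeff (-((c.w k : ℝ) * ((c.z k : ℝ) * (c.zb k : ℝ)) ^ σ))
        (((c.z k : ℝ) * (c.zb k : ℝ)) ^ δ) m *
      (((1 - (c.z k : ℝ)) * (1 - (c.zb k : ℝ))) ^ (Δ / 2) *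
        nodeHead ℓ nF (1 - (c.z k : ℝ)) (1 - (c.zb k : ℝ)) Δ)

/-- [folklore] -/
theorem nodeG_eq_nodeGN (c : PCert) (ℓ nF : ℕ) (σ δ : ℝ) (k : Fin c.N) (m : ℕ) (Δ : ℝ) :
    nodeG c.wR c.zR c.zbR ℓ nF σ δ k m Δ = nodeGN c ℓ nF σ δ k m Δ := rfl

/-- the real exponent of a request. [folklore] -/
noncomputable def expoR (c : PCert) (r : PowReq) : ℝ := ((r.expo c.rho : ℚ) : ℝ)

/-- **Soundness of a node side.** [cite: HogervorstRychkov2013, §3 eq. (3.6)] -/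
theorem tmem_sideG {c : PCert} (hc : c.checkNodes = true) {t : TMCell} {p : TMPiece} (hD : 1 ≤ t.D)
    (hK : 0 < t.K) (hℓ : Even t.ℓ) (hpiv : HRTM.pivOK t.A t.ℓ t.e t.nF = true) (hrA : t.rA.ok = true)
    (hrS : p.rSig.ok = true) (hrD : p.rDel.ok = true) (hA : t.rA.expo c.rho = t.A / 2) {k : ℕ}
    (hk : k < c.N) {g1 g2 : G3}
    (h1 : sideG c t p (HRTM.rows c.S t.A t.ℓ t.e t.D t.nF) k true = some g1)
    (h2 : sideG c t p (HRTM.rows c.S t.A t.ℓ t.e t.D t.nF) k false = some g2) :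
    ∀ m, m ≤ 2 → TMem c.S t.h (fun ρ => nodeGN c t.ℓ t.nF (expoR c p.rSig) (expoR c p.rDel) k m ((t.A : ℝ) + ρ))
      (gsel (addG g1 g2) m) := by
  have hS := PCert.S_pos hc
  have hn := PCert.checkNode_of_checkNodes hc hk
  have hz := PCert.z_pos hn
  have hzb := PCert.zb_pos hn
  have hz1 := PCert.z_lt_one hn
  have hzb1 := PCert.zb_lt_one hn
  have hAe : ((t.rA.expo c.rho : ℚ) : ℝ) = (t.A : ℝ) / 2 := by rw [hA]; push_cast; ring
  -- casts of `u_k`, `v_k`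
  have eu : ((c.u k : ℚ) : ℝ) = (c.z k : ℝ) * (c.zb k : ℝ) := by rw [PCert.u]; push_cast; ring
  have ev : ((c.v k : ℚ) : ℝ) = (1 - (c.z k : ℝ)) * (1 - (c.zb k : ℝ)) := by rw [PCert.v]; push_cast; ring
  have hz1r : ((c.z k : ℚ) : ℝ) < 1 := by exact_mod_cast hz1
  have hzb1r : ((c.zb k : ℚ) : ℝ) < 1 := by exact_mod_cast hzb1
  have hvpos : (0 : ℝ) < (1 - (c.z k : ℝ)) * (1 - (c.zb k : ℝ)) :=
    mul_pos (by linarith) (by linarith)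
  have hupos : (0 : ℝ) < (c.z k : ℝ) * (c.zb k : ℝ) :=
    mul_pos (by exact_mod_cast hz) (by exact_mod_cast hzb)
  unfold sideG at h1 h2
  simp only [if_true] at h1
  simp only [Bool.false_eq_true, if_false] at h2
  -- plus side
  have hamp1 : MI.mem c.S ((c.w k : ℝ) * ((1 - (c.z k : ℝ)) * (1 - (c.zb k : ℝ))) ^ expoR c p.rSig)
      (mulQ (c.powV k p.rSig) (c.w k)) := by
    have := mem_mulQ (PCert.mem_powV hn hS p.rSig hrS) (c.w k)
    rw [ev] at this
    simpa [expoR, mul_comm] using this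
  have hR1 : MI.mem c.S (((1 - (c.z k : ℝ)) * (1 - (c.zb k : ℝ))) ^ expoR c p.rDel) (c.powV k p.rDel) := by
    have := PCert.mem_powV hn hS p.rDel hrD; rwa [ev] at this
  have hEf1 : MI.mem c.S (((c.z k * c.zb k : ℚ) : ℝ) ^ ((t.A : ℝ) / 2)) (c.powU k t.rA) := by
    have := PCert.mem_powU hn hS t.rA hrA
    rwa [hAe, show c.u k = c.z k * c.zb k from rfl] at this
  have hlo1 : decide (0 ≤ c.w k) = true ↔
      0 ≤ (c.w k : ℝ) * ((1 - (c.z k : ℝ)) * (1 - (c.zb k : ℝ))) ^ expoR c p.rSig := by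
    rw [decide_eq_true_iff, mul_nonneg_iff_of_pos_right (Real.rpow_pos_of_pos hvpos _)]
    exact ⟨fun h => by exact_mod_cast h, fun h => by exact_mod_cast h⟩
  have P1 := tmem_sideCore hS hD hK hℓ hpiv hz hzb hamp1 hR1 hEf1 hlo1 h1
  -- minus side
  have hx2 : 0 < 1 - c.z k := by linarith
  have hy2 : 0 < 1 - c.zb k := by linarith
  have hamp2 : MI.mem c.S (-((c.w k : ℝ) * ((c.z k : ℝ) * (c.zb k : ℝ)) ^ expoR c p.rSig))
      (mulQ (c.powU k p.rSig) (-(c.w k))) := by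
    have := mem_mulQ (PCert.mem_powU hn hS p.rSig hrS) (-(c.w k))
    rw [eu] at this
    simpa [expoR, mul_comm] using this
  have hR2 : MI.mem c.S (((c.z k : ℝ) * (c.zb k : ℝ)) ^ expoR c p.rDel) (c.powU k p.rDel) := by
    have := PCert.mem_powU hn hS p.rDel hrD; rwa [eu] at this
  have hEf2 : MI.mem c.S ((((1 - c.z k) * (1 - c.zb k) : ℚ) : ℝ) ^ ((t.A : ℝ) / 2)) (c.powV k t.rA) := by
    have := PCert.mem_powV hn hS t.rA hrA
    rwa [hAe, show c.v k = (1 - c.z k) * (1 - c.zb k) from rfl] at this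
  have hlo2 : decide (c.w k ≤ 0) = true ↔
      0 ≤ -((c.w k : ℝ) * ((c.z k : ℝ) * (c.zb k : ℝ)) ^ expoR c p.rSig) := by
    have hP := Real.rpow_pos_of_pos hupos (expoR c p.rSig)
    rw [decide_eq_true_iff]
    constructor
    · intro h
      have h' : ((c.w k : ℚ) : ℝ) ≤ 0 := by exact_mod_cast h
      nlinarith
    · intro h
      have h' : ((c.w k : ℚ) : ℝ) ≤ 0 := by
        by_contra hneg
        have := mul_pos (lt_of_not_ge hneg) hP
        linarith
      exact_mod_cast h'
  have P2 := tmem_sideCore hS hD hK hℓ hpiv hx2 hy2 hamp2 hR2 hEf2 hlo2 h2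
  intro m hm
  rw [gsel_addG]
  refine tmem_congr_on (tmem_add (P1 m hm) (P2 m hm)) fun ρ _ => ?_
  simp only [nodeGN]
  push_cast
  ring

/-! ### Node groups -/

/-- accumulate the nodes `k, …, k+n-1` onto `acc`. [folklore] -/
def gPartAux (c : PCert) (t : TMCell) (p : TMPiece) (rs : List (List IPoly)) : ℕ → ℕ → G3 → Option G3
  | 0, _, acc => some acc
  | n + 1, k, acc =>
    match sideG c t p rs k true, sideG c t p rs k false with
    | some g1, some g2 => gPartAux c t p rs n (k + 1) (addG acc (addG g1 g2))
    | _, _ => none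

/-- The models of the node group `klo ≤ k < khi` (recursion table computed once). [folklore] -/
def gPart (c : PCert) (t : TMCell) (p : TMPiece) (klo khi : ℕ) : Option G3 :=
  gPartAux c t p (HRTM.rows c.S t.A t.ℓ t.e t.D t.nF) (khi - klo) klo ([], [], [])

section Sound

variable {c : PCert} (hc : c.checkNodes = true) {t : TMCell} {p : TMPiece} (hD : 1 ≤ t.D)
  (hK : 0 < t.K) (hℓ : Even t.ℓ) (hpiv : HRTM.pivOK t.A t.ℓ t.e t.nF = true) (hrA : t.rA.ok = true)
  (hrS : p.rSig.ok = true) (hrD : p.rDel.ok = true) (hA : t.rA.expo c.rho = t.A / 2)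
include hc hD hK hℓ hpiv hrA hrS hrD hA

/-- [folklore] -/
theorem tmem_gPartAux : ∀ (n k : ℕ) (acc : G3) {g : G3} (F : ℕ → ℝ → ℝ),
    (∀ m, m ≤ 2 → TMem c.S t.h (F m) (gsel acc m)) → k + n ≤ c.N →
    gPartAux c t p (HRTM.rows c.S t.A t.ℓ t.e t.D t.nF) n k acc = some g →
    ∀ m, m ≤ 2 → TMem c.S t.h (fun ρ => F m ρ + ∑ i ∈ Finset.Ico k (k + n),
      nodeGN c t.ℓ t.nF (expoR c p.rSig) (expoR c p.rDel) i m ((t.A : ℝ) + ρ)) (gsel g m)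
  | 0, k, acc, g, F, hF, _, h, m, hm => by
    simp only [gPartAux, Option.some.injEq] at h
    subst h
    exact tmem_congr_on (hF m hm) fun ρ _ => by simp
  | n + 1, k, acc, g, F, hF, hkN, h, m, hm => by
    simp only [gPartAux] at h
    cases h1 : sideG c t p (HRTM.rows c.S t.A t.ℓ t.e t.D t.nF) k true with
    | none => simp [h1] at h
    | some g1 =>
      cases h2 : sideG c t p (HRTM.rows c.S t.A t.ℓ t.e t.D t.nF) k false with
      | none => simp [h1, h2] at h
      | some g2 =>
        simp only [h1, h2] at h
        have hk : k < c.N := by omega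
        have hnode := tmem_sideG hc hD hK hℓ hpiv hrA hrS hrD hA hk h1 h2
        have hacc : ∀ m, m ≤ 2 → TMem c.S t.h (fun ρ => F m ρ +
            nodeGN c t.ℓ t.nF (expoR c p.rSig) (expoR c p.rDel) k m ((t.A : ℝ) + ρ))
            (gsel (addG acc (addG g1 g2)) m) := fun m hm => by
          rw [gsel_addG]; exact tmem_add (hF m hm) (hnode m hm)
        have ih := tmem_gPartAux n (k + 1) (addG acc (addG g1 g2)) _ hacc (by omega) h m hm
        refine tmem_congr_on ih fun ρ _ => ?_
        rw [Finset.sum_eq_sum_Ico_succ_bot (by omega : k < k + (n + 1)),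
          show k + 1 + n = k + (n + 1) by omega]
        ring

omit hc hD hK hℓ hpiv hrA hrS hrD hA in
/-- [folklore] -/
theorem gsel_empty : ∀ m, gsel (([], [], []) : G3) m = []
  | 0 => rfl
  | 1 => rfl
  | _ + 2 => rfl

omit hc hD hK hℓ hpiv hrA hrS hrD hA in
/-- [folklore] -/
theorem sumG_cons (g : G3) (gs : List G3) : sumG (g :: gs) = addG g (sumG gs) := rfl

/-- **Soundness of a node group.** [cite: HogervorstRychkov2013, §3 eq. (3.6)] -/
theorem tmem_gPart {klo khi : ℕ} {g : G3} (h : gPart c t p klo khi = some g) (hN : khi ≤ c.N)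
    (hkk : klo ≤ khi) : ∀ m, m ≤ 2 → TMem c.S t.h (fun ρ => ∑ i ∈ Finset.Ico klo khi,
      nodeGN c t.ℓ t.nF (expoR c p.rSig) (expoR c p.rDel) i m ((t.A : ℝ) + ρ)) (gsel g m) := by
  intro m hm
  have h0 : ∀ m, m ≤ 2 → TMem c.S t.h ((fun _ _ => (0 : ℝ)) m) (gsel (([], [], []) : G3) m) :=
    fun m _ => by rw [gsel_empty]; exact HRTM.tmem_nil_zero c.S t.h
  have := tmem_gPartAux hc hD hK hℓ hpiv hrA hrS hrD hA (khi - klo) klo ([], [], [])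
    (fun _ _ => (0 : ℝ)) h0 (by omega) h m hm
  refine tmem_congr_on this fun ρ _ => ?_
  simp only [zero_add, show klo + (khi - klo) = khi by omega]

/-- `gs` are the group models of a consecutive partition of the nodes `k₀ ≤ k < k₁`. [folklore] -/
inductive PartsOK (c : PCert) (t : TMCell) (p : TMPiece) : ℕ → ℕ → List G3 → Prop
  | nil (k : ℕ) : PartsOK c t p k k []
  | cons {k0 k k1 : ℕ} {g : G3} {gs : List G3} (hk : k0 ≤ k) (h : gPart c t p k0 k = some g)
      (hs : PartsOK c t p k k1 gs) : PartsOK c t p k0 k1 (g :: gs)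

omit hc hD hK hℓ hpiv hrA hrS hrD hA in
/-- [folklore] -/
theorem PartsOK.le {k0 k1 : ℕ} {gs : List G3} (h : PartsOK c t p k0 k1 gs) : k0 ≤ k1 := by
  induction h with
  | nil k => exact le_rfl
  | cons hk _ _ ih => exact hk.trans ih

/-- **Soundness over a partition.** [folklore] -/
theorem tmem_parts {k0 k1 : ℕ} {gs : List G3} (hP : PartsOK c t p k0 k1 gs) (hN : k1 ≤ c.N) :
    ∀ m, m ≤ 2 → TMem c.S t.h (fun ρ => ∑ i ∈ Finset.Ico k0 k1,
      nodeGN c t.ℓ t.nF (expoR c p.rSig) (expoR c p.rDel) i m ((t.A : ℝ) + ρ)) (gsel (sumG gs) m) := by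
  induction hP with
  | nil k =>
    intro m _
    rw [show sumG ([] : List G3) = ([], [], []) from rfl, gsel_empty]
    exact HRTM.tmem_nil_of_eq_zero fun ρ => by simp
  | cons hk h hs ih =>
    intro m hm
    rw [sumG_cons, gsel_addG]
    refine tmem_congr_on (tmem_add (tmem_gPart hc hD hK hℓ hpiv hrA hrS hrD hA h (hs.le.trans hN) hk m hm)
      (ih hN m hm)) fun ρ _ => ?_
    rw [Finset.sum_Ico_consecutive _ hk hs.le]

/-! ### The cell number and the main theorem -/

omit hc hD hK hℓ hpiv hrA hrS hrD hA in
/-- `lower3` of the summed models: the cell passes iff `0 ≤ cellNumber`. [folklore] -/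
def cellNumber (S : ℕ) (h : ℚ) (gs : List G3) : ℤ :=
  lower3 S h (sumG gs).1 (sumG gs).2.1 (sumG gs).2.2

/-- **Main theorem of the v3 kernel**: a non-negative cell number gives the `hpos` hypothesis of
`blockPositive_pointFunctional_of_headG_Ico` on `[A - h, A + h]`.
[cite: HogervorstRychkov2013, §3 eq. (3.6)] -/
theorem headG_nonneg_of_cellNumber {gs : List G3} (hP : PartsOK c t p 0 c.N gs)
    (hnum : 0 ≤ cellNumber c.S t.h gs) :
    ∀ Δ ∈ Icc ((t.A : ℝ) - t.h) ((t.A : ℝ) + t.h), ∀ θ ∈ Icc (0 : ℝ) 1,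
      0 ≤ headG c.wR c.zR c.zbR t.ℓ t.nF (expoR c p.rSig) (expoR c p.rDel) 0 Δ
        + θ * headG c.wR c.zR c.zbR t.ℓ t.nF (expoR c p.rSig) (expoR c p.rDel) 1 Δ
        + θ ^ 2 * headG c.wR c.zR c.zbR t.ℓ t.nF (expoR c p.rSig) (expoR c p.rDel) 2 Δ := by
  intro Δ hΔ θ hθ
  have hS := PCert.S_pos hc
  have hSr : (0 : ℝ) < c.S := by exact_mod_cast hS
  have hh0 : 0 ≤ t.h := by unfold TMCell.h; positivity
  have hρ : |Δ - t.A| ≤ (t.h : ℝ) := abs_le.mpr ⟨by linarith [hΔ.1], by linarith [hΔ.2]⟩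
  have hG := tmem_parts hc hD hK hℓ hpiv hrA hrS hrD hA hP le_rfl
  have hmain := lower3_le hh0 (hG 0 (by norm_num)) (hG 1 (by norm_num)) (hG 2 le_rfl) hθ.1 hθ.2 hρ
  have e : ∀ m, headG c.wR c.zR c.zbR t.ℓ t.nF (expoR c p.rSig) (expoR c p.rDel) m Δ =
      ∑ i ∈ Finset.Ico 0 c.N, nodeGN c t.ℓ t.nF (expoR c p.rSig) (expoR c p.rDel) i m
        ((t.A : ℝ) + (Δ - t.A)) := by
    intro m
    rw [show (t.A : ℝ) + (Δ - t.A) = Δ by ring, ← Finset.range_eq_Ico]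
    unfold headG
    simp only [nodeG_eq_nodeGN]
    exact Fin.sum_univ_eq_sum_range
      (fun i => nodeGN c t.ℓ t.nF (expoR c p.rSig) (expoR c p.rDel) i m Δ) c.N
  have h0 : (0 : ℝ) ≤ (lower3 c.S t.h (gsel (sumG gs) 0) (gsel (sumG gs) 1) (gsel (sumG gs) 2) : ℤ) := by
    have : 0 ≤ lower3 c.S t.h (gsel (sumG gs) 0) (gsel (sumG gs) 1) (gsel (sumG gs) 2) := hnum
    exact_mod_cast this
  rw [e 0, e 1, e 2]
  by_contra hneg
  have := mul_neg_of_neg_of_pos (lt_of_not_ge hneg) hSr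
  linarith

end Sound

end PKTM

end Literature.MathematicalPhysics.QuantumFieldTheory.ConformalBootstrap3D
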